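import Summits.CriticalPhenomena.PercolationContinuityZ3.Theorems.PercNearOneGluingNoHeavyQuantTorqueSplitRoutes
import HarnessLib

/-!
# QUANT lane R8, T-DEC: TWO LOW ATOMS, SIX ROUTES — water-filling under Hall's conditions with BOTH costly absorbers shared
# (arm-1 gen 55, architect)

builds on p205010 (kernel theorem, internal audit signed; external expert review pending)

Support file (`--supports stmt-CriticalPhenomena-4575`), QUANT lane seat prim-quant-arm-1 (gen 55, architect); memo
`run/shared/lean/prim/quant/prim-quant-arm-1-g55/ARCH-G55.md` §2.  Theorems only, standard axioms, no sorries.  A variant of this seat's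
`decAt_all_of_split12` / `decAt_all_of_hall12` (`…QuantTorqueSplitRoutes`, `…QuantTorqueHall`) in which the low atom `2` may also use
the capacity of the absorber `5` left over by the low atom `1` (route `2 → 5`, cost-safe per unit for `T ≥ 4`): with `N(1) = {5,6} ⊆
N(2) = {3,4,5,6}` Hall's conditions reduce to TWO (`U ≤ c₆`, `U + V ≤ c₆`) — the separate capacity condition of the low atom `2`, whose
certificate for three 2-chains is the largest of the family (kit j274605/j274885: 700 products), disappears — at the price of one more
torque-cost condition (`U ≤ R′`).

* **`decAt_all_of_split12b`** (`4 < T < 6` on `{0..6}`): prescribed flows on `1 → {5,6}`, `2 → {3,4,5,6}` ⟹ DEC at every layer;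
* **`decAt_all_of_hall12b`** (`4 < T < 6`, `6y ≤ T`): the water-filling "`1` fills `5` then `6`; `2` fills `3`, `4`, the rest of `5`, then `6`"
  from `U ≤ c₆`, `U + V ≤ c₆`, `U ≤ R`, `U ≤ R′`, `U + 2V ≤ R′` (`U = μ₁ − c₅`, `V = μ₂ − c₃ − c₄`, `R = (T−2)μ₂ + (T−3)μ₃ + (T−4)μ₄`,
  `R′ = (T−2)(c₃ + c₄) + (T−3)μ₃ + (T−4)μ₄`), all stated multiplied through by `T`.

HONEST STATUS.  Pure bookkeeping; `SiblingStep`, `GateStepN`, `LightResidDECOracle`, `FarTreeRow` OPEN; RATE class (log\*) / honest sentence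
of `run/shared/lean/prim/quant/README.md` unchanged.  [this work].  Nothing here is cited as a published result.  The gluing rows served
[cite: KozmaNitzan2024, Conjecture 3 (p. 15)]; product measure [cite: Grimmett1999, §1.3 p. 10].
-/

noncomputable section

open scoped BigOperators

namespace Summit.CriticalPhenomena.PercolationContinuityZ3.Theorems
namespace Quant
namespace LawDec

open Finset

/-- the torque budget of a law on `{0..6}` with `T > 4` dominates its first four terms. [this work] -/
theorem budget_ge_four (μ : ℕ → ℝ) (T : ℝ) (hμ0 : ∀ h, 0 ≤ μ h) (hT4 : 4 < T) :
    (T - 1) * μ 1 + (T - 2) * μ 2 + ((T - 3) * μ 3 + (T - 4) * μ 4)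
      ≤ ∑ l ∈ Finset.range (6 + 1), (if (1 ≤ l ∧ (l : ℝ) < T) then μ l * (T - l) else 0) := by
  simp only [Finset.sum_range_succ, Finset.sum_range_zero]
  norm_num
  rw [if_pos (by linarith : (1 : ℝ) < T), if_pos (by linarith : (2 : ℝ) < T), if_pos (by linarith : (3 : ℝ) < T),
    if_pos (by linarith : (4 : ℝ) < T)]
  have h5 : 0 ≤ (if (5 : ℝ) < T then μ 5 * (T - 5) else 0) := by
    split_ifs with h
    · exact mul_nonneg (hμ0 5) (by linarith)
    · exact le_rfl
  have h6 : 0 ≤ (if (6 : ℝ) < T then μ 6 * (T - 6) else 0) := by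
    split_ifs with h
    · exact mul_nonneg (hμ0 6) (by linarith)
    · exact le_rfl
  linarith

/-- **TWO LOW ATOMS, SIX ROUTES (`4 < T < 6` on `{0..6}`)**: flows `x₁₅ + x₁₆ = μ 1`, `x₂₃ + x₂₄ + x₂₅ + x₂₆ = μ 2` (the route `2 → 3` only
while `T < 5`), loads within capacity at the layer-free rates (absorbers `5` and `6` shared), and the torque cost of the costly routes (into
`5` while `T < 5`; into `6`) at most the budget ⟹ DEC at every layer below the top. [this work] -/
theorem decAt_all_of_split12b (y : ℝ) (x₁₅ x₁₆ x₂₃ x₂₄ x₂₅ x₂₆ : ℝ) (μ : ℕ → ℝ) (T : ℝ) (hy0 : 0 < y) (hy1 : y < 1)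
    (hμ0 : ∀ h, 0 ≤ μ h) (hμM : ∀ h, 6 < h → μ h = 0) (hμ1 : ∑ h ∈ Finset.range (6 + 1), μ h = 1)
    (hT : ∑ h ∈ Finset.range (6 + 1), (h : ℝ) * μ h = T) (hT4 : 4 < T) (hT6 : T < 6) (hta : y * ((6 : ℕ) : ℝ) ≤ T)
    (h15 : 0 ≤ x₁₅) (h16 : 0 ≤ x₁₆) (h23 : 0 ≤ x₂₃) (h24 : 0 ≤ x₂₄) (h25 : 0 ≤ x₂₅) (h26 : 0 ≤ x₂₆)
    (hrow1 : x₁₅ + x₁₆ = μ 1) (hrow2 : x₂₃ + x₂₄ + x₂₅ + x₂₆ = μ 2) (hc23 : 0 < x₂₃ → T < 5)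
    (hcap3 : freeRate y T 2 3 * x₂₃ ≤ μ 3) (hcap4 : freeRate y T 2 4 * x₂₄ ≤ μ 4)
    (hcap5 : freeRate y T 1 5 * x₁₅ + freeRate y T 2 5 * x₂₅ ≤ μ 5)
    (hcap6 : freeRate y T 1 6 * x₁₆ + freeRate y T 2 6 * x₂₆ ≤ μ 6)
    (hcost : (if T < 5 then (5 - T) * (freeRate y T 1 5 * x₁₅ + freeRate y T 2 5 * x₂₅) else 0)
        + (6 - T) * (freeRate y T 1 6 * x₁₆ + freeRate y T 2 6 * x₂₆)
        ≤ ∑ l ∈ Finset.range (6 + 1), (if (1 ≤ l ∧ (l : ℝ) < T) then μ l * (T - l) else 0)) :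
    ∀ j', j' < 6 → DECAt y j' 6 μ := by
  have hT0 : 0 < T := by linarith
  set F : ℕ → ℕ → ℝ := fun l h =>
    if l = 1 then (if h = 5 then x₁₅ else 0) + (if h = 6 then x₁₆ else 0)
    else if l = 2 then (if h = 3 then x₂₃ else 0) + (if h = 4 then x₂₄ else 0) + (if h = 5 then x₂₅ else 0) + (if h = 6 then x₂₆ else 0)
    else 0 with hF
  -- loads
  have load : ∀ h, ∑ l ∈ Finset.range (6 + 1), freeRate y T l h * F l h
      = (if h = 5 then freeRate y T 1 5 * x₁₅ else 0) + (if h = 6 then freeRate y T 1 6 * x₁₆ else 0)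
        + (if h = 3 then freeRate y T 2 3 * x₂₃ else 0) + (if h = 4 then freeRate y T 2 4 * x₂₄ else 0)
        + (if h = 5 then freeRate y T 2 5 * x₂₅ else 0) + (if h = 6 then freeRate y T 2 6 * x₂₆ else 0) := by
    intro h
    simp only [hF, Finset.sum_range_succ, Finset.sum_range_zero]
    norm_num
    by_cases e3 : h = 3
    · subst e3; norm_num
    by_cases e4 : h = 4
    · subst e4; norm_num
    by_cases e5 : h = 5
    · subst e5; norm_num
    by_cases e6 : h = 6
    · subst e6; norm_num
    simp [e3, e4, e5, e6]
  refine decAt_all_of_torqueCost y 6 μ T F hy0 hy1 hμ0 hμM hμ1 hT hT0 hta ?_ ?_ ?_ ?_ ?_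
  · intro l h; simp only [hF]; split_ifs <;> linarith
  · intro l h hpos
    simp only [hF] at hpos
    by_cases l1 : l = 1
    · subst l1; rw [if_pos rfl] at hpos
      by_cases e5 : h = 5
      · subst e5; exact ⟨le_rfl, by push_cast; linarith, by norm_num, by norm_num, by push_cast; linarith⟩
      by_cases e6 : h = 6
      · subst e6; exact ⟨le_rfl, by push_cast; linarith, by norm_num, by norm_num, by push_cast; linarith⟩
      rw [if_neg e5, if_neg e6] at hpos; linarith
    by_cases l2 : l = 2
    · subst l2; rw [if_neg (by norm_num), if_pos rfl] at hpos
      by_cases e3 : h = 3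
      · subst e3
        rw [if_pos rfl, if_neg (by norm_num), if_neg (by norm_num), if_neg (by norm_num), add_zero, add_zero, add_zero] at hpos
        exact ⟨by norm_num, by push_cast; linarith, by norm_num, by norm_num, by push_cast; linarith [hc23 hpos]⟩
      by_cases e4 : h = 4
      · subst e4; exact ⟨by norm_num, by push_cast; linarith, by norm_num, by norm_num, by push_cast; linarith⟩
      by_cases e5 : h = 5
      · subst e5; exact ⟨by norm_num, by push_cast; linarith, by norm_num, by norm_num, by push_cast; linarith⟩
      by_cases e6 : h = 6
      · subst e6; exact ⟨by norm_num, by push_cast; linarith, by norm_num, by norm_num, by push_cast; linarith⟩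
      rw [if_neg e3, if_neg e4, if_neg e5, if_neg e6] at hpos; linarith
    rw [if_neg l1, if_neg l2] at hpos; exact absurd hpos (lt_irrefl 0)
  · intro l hl hlow
    by_cases l1 : l = 1
    · subst l1; simp only [hF, Finset.sum_range_succ, Finset.sum_range_zero]; norm_num; linarith
    by_cases l2 : l = 2
    · subst l2; simp only [hF, Finset.sum_range_succ, Finset.sum_range_zero]; norm_num; linarith
    exfalso
    have : (3 : ℝ) ≤ l := by exact_mod_cast (show 3 ≤ l by omega)
    linarith
  · intro h hh
    rw [load h]
    interval_cases h
    · norm_num; exact hμ0 0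
    · norm_num; exact hμ0 1
    · norm_num; exact hμ0 2
    · norm_num; exact hcap3
    · norm_num; exact hcap4
    · norm_num; exact hcap5
    · norm_num; exact hcap6
  · have e : ∑ h ∈ Finset.range (6 + 1), (if T < (h : ℝ) then ((h : ℝ) - T) * ∑ l ∈ Finset.range (6 + 1), freeRate y T l h * F l h else 0)
        = (if T < 5 then (5 - T) * (freeRate y T 1 5 * x₁₅ + freeRate y T 2 5 * x₂₅) else 0)
          + (6 - T) * (freeRate y T 1 6 * x₁₆ + freeRate y T 2 6 * x₂₆) := by
      simp only [load, Finset.sum_range_succ, Finset.sum_range_zero]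
      norm_num
      rw [if_neg (by linarith : ¬ T < 3), if_neg (by linarith : ¬ T < 4), if_pos hT6]
      ring
    rw [e]; exact hcost

/-- **WATER-FILLING UNDER HALL'S CONDITIONS, BOTH COSTLY ABSORBERS SHARED (`4 < T < 6`, `6y ≤ T`, laws on `{0..6}`).**  With
`κ = T/(6−T)`, capacities in units of low mass `c₅ = (6−T)μ₅/T`, `c₄ = (6−T)μ₄/T`, `c₆ = (6−T)μ₆/T`, a prescribed `c₃ ≥ 0` on the absorber `3`
(`c₃ = 0`, or `T ≤ 24/5` and `κ·c₃ ≤ μ₃`), `U = μ₁ − c₅`, `V = μ₂ − c₃ − c₄`, `R = (T−2)μ₂ + (T−3)μ₃ + (T−4)μ₄`, `R′ = (T−2)(c₃+c₄) + (T−3)μ₃ +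
(T−4)μ₄`: IF `U ≤ c₆`, `U + V ≤ c₆` (Hall, `N(1) ⊆ N(2)`) and `U ≤ R`, `U ≤ R′`, `U + 2V ≤ R′` (torque cost) — all multiplied through by `T` —
THEN DEC at every layer below the top, by the transport "`1` fills `5` then `6`; `2` fills `3`, `4`, the rest of `5`, then `6`". [this work] -/
theorem decAt_all_of_hall12b (y : ℝ) (μ : ℕ → ℝ) (T c₃ : ℝ) (hy0 : 0 < y) (hy1 : y < 1)
    (hμ0 : ∀ h, 0 ≤ μ h) (hμM : ∀ h, 6 < h → μ h = 0) (hμ1 : ∑ h ∈ Finset.range (6 + 1), μ h = 1)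
    (hT : ∑ h ∈ Finset.range (6 + 1), (h : ℝ) * μ h = T) (hT4 : 4 < T) (hT6 : T < 6) (hyT : 6 * y ≤ T)
    (hc₃0 : 0 ≤ c₃) (hc₃ : c₃ = 0 ∨ (5 * T ≤ 24 ∧ T * c₃ ≤ (6 - T) * μ 3))
    (hU6 : T * μ 1 ≤ (6 - T) * (μ 5 + μ 6))
    (hUV6 : T * (μ 1 + μ 2) ≤ T * c₃ + (6 - T) * (μ 4 + μ 5 + μ 6))
    (hUR : T * μ 1 - (6 - T) * μ 5 ≤ T * ((T - 2) * μ 2 + (T - 3) * μ 3 + (T - 4) * μ 4))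
    (hUR' : T * μ 1 - (6 - T) * μ 5 ≤ (T - 2) * (T * c₃ + (6 - T) * μ 4) + T * ((T - 3) * μ 3 + (T - 4) * μ 4))
    (hUVR' : T * μ 1 - (6 - T) * μ 5 + 2 * (T * μ 2) ≤ T * (T * c₃) + T * ((T - 3) * μ 3) + 2 * (T * μ 4)) :
    ∀ j', j' < 6 → DECAt y j' 6 μ := by
  have hT0 : 0 < T := by linarith
  have h6T : 0 < 6 - T := by linarith
  set κ : ℝ := T / (6 - T) with hκ
  set M34 : ℝ := (T - 3) * μ 3 + (T - 4) * μ 4 with hM34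
  set c₅ : ℝ := (6 - T) * μ 5 / T with hc₅
  set c₄ : ℝ := (6 - T) * μ 4 / T with hc₄
  set c₆ : ℝ := (6 - T) * μ 6 / T with hc₆
  have hc₅0 : 0 ≤ c₅ := div_nonneg (mul_nonneg h6T.le (hμ0 5)) hT0.le
  have hc₄0 : 0 ≤ c₄ := div_nonneg (mul_nonneg h6T.le (hμ0 4)) hT0.le
  have hc₆0 : 0 ≤ c₆ := div_nonneg (mul_nonneg h6T.le (hμ0 6)) hT0.le
  have hTc₅ : T * c₅ = (6 - T) * μ 5 := by rw [hc₅]; field_simp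
  have hTc₄ : T * c₄ = (6 - T) * μ 4 := by rw [hc₄]; field_simp
  have hTc₆ : T * c₆ = (6 - T) * μ 6 := by rw [hc₆]; field_simp
  have hκT : (6 - T) * κ = T := by rw [hκ]; field_simp
  have hκ0 : 0 ≤ κ := div_nonneg hT0.le h6T.le
  have hκc₅ : κ * c₅ = μ 5 := by
    have e : (6 - T) * (κ * c₅) = (6 - T) * μ 5 := by rw [← mul_assoc, hκT, hTc₅]
    exact mul_left_cancel₀ h6T.ne' e
  have hκc₄ : κ * c₄ = μ 4 := by
    have e : (6 - T) * (κ * c₄) = (6 - T) * μ 4 := by rw [← mul_assoc, hκT, hTc₄]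
    exact mul_left_cancel₀ h6T.ne' e
  have hκc₆ : κ * c₆ = μ 6 := by
    have e : (6 - T) * (κ * c₆) = (6 - T) * μ 6 := by rw [← mul_assoc, hκT, hTc₆]
    exact mul_left_cancel₀ h6T.ne' e
  have hci1 : (5 - T) * κ ≤ T - 1 := by
    have e : (6 - T) * ((5 - T) * κ) = (5 - T) * T := by
      calc (6 - T) * ((5 - T) * κ) = (5 - T) * ((6 - T) * κ) := by ring
        _ = (5 - T) * T := by rw [hκT]
    have h2 : (6 - T) * ((5 - T) * κ) ≤ (6 - T) * (T - 1) := by rw [e]; nlinarith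
    exact le_of_mul_le_mul_left h2 h6T
  have hci2 : (5 - T) * κ ≤ T - 2 := by
    have e : (6 - T) * ((5 - T) * κ) = (5 - T) * T := by
      calc (6 - T) * ((5 - T) * κ) = (5 - T) * ((6 - T) * κ) := by ring
        _ = (5 - T) * T := by rw [hκT]
    have h2 : (6 - T) * ((5 - T) * κ) ≤ (6 - T) * (T - 2) := by rw [e]; nlinarith
    exact le_of_mul_le_mul_left h2 h6T
  -- the five conditions in units of low mass
  have hU6' : μ 1 - c₅ ≤ c₆ := by
    refine le_of_mul_le_mul_left ?_ hT0
    have : T * (μ 1 - c₅) = T * μ 1 - T * c₅ := by ring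
    linarith
  have hUV6' : (μ 1 - c₅) + (μ 2 - c₃ - c₄) ≤ c₆ := by
    refine le_of_mul_le_mul_left ?_ hT0
    have : T * ((μ 1 - c₅) + (μ 2 - c₃ - c₄)) = T * μ 1 + T * μ 2 - T * c₃ - T * c₅ - T * c₄ := by ring
    have : T * (μ 1 + μ 2) = T * μ 1 + T * μ 2 := by ring
    linarith
  have hUR1 : μ 1 - c₅ ≤ (T - 2) * μ 2 + M34 := by
    refine le_of_mul_le_mul_left ?_ hT0
    have : T * (μ 1 - c₅) = T * μ 1 - T * c₅ := by ring
    have : T * ((T - 2) * μ 2 + M34) = T * ((T - 2) * μ 2 + (T - 3) * μ 3 + (T - 4) * μ 4) := by rw [hM34]; ring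
    linarith
  have hUR2 : μ 1 - c₅ ≤ (T - 2) * (c₃ + c₄) + M34 := by
    refine le_of_mul_le_mul_left ?_ hT0
    have : T * (μ 1 - c₅) = T * μ 1 - T * c₅ := by ring
    have : T * ((T - 2) * (c₃ + c₄) + M34) = (T - 2) * (T * c₃ + T * c₄) + T * M34 := by ring
    have : (T - 2) * (T * c₄) = (T - 2) * ((6 - T) * μ 4) := by rw [hTc₄]
    linarith
  have hUVR : (μ 1 - c₅) + 2 * (μ 2 - c₃ - c₄) ≤ (T - 2) * (c₃ + c₄) + M34 := by
    refine le_of_mul_le_mul_left ?_ hT0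
    have e1 : T * ((μ 1 - c₅) + 2 * (μ 2 - c₃ - c₄)) = T * μ 1 - T * c₅ + 2 * (T * μ 2) - 2 * (T * c₃) - 2 * (T * c₄) := by ring
    have e2 : T * ((T - 2) * (c₃ + c₄) + M34) = (T - 2) * (T * c₃) + (T - 2) * (T * c₄) + T * ((T - 3) * μ 3) + T * ((T - 4) * μ 4) := by
      rw [hM34]; ring
    rw [e1, e2]
    have hT2c₄ : (T - 2) * (T * c₄) = (T - 2) * ((6 - T) * μ 4) := by rw [hTc₄]
    linarith
  have hM0 : 0 ≤ M34 := by rw [hM34]; exact add_nonneg (mul_nonneg (by linarith) (hμ0 3)) (mul_nonneg (by linarith) (hμ0 4))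
  -- the water-filling flows
  set x₁₅ : ℝ := min (μ 1) c₅ with hx₁₅
  set x₁₆ : ℝ := μ 1 - x₁₅ with hx₁₆
  set r₅ : ℝ := c₅ - x₁₅ with hr₅
  set x₂₃ : ℝ := min (μ 2) c₃ with hx₂₃
  set x₂₄ : ℝ := min (μ 2 - x₂₃) c₄ with hx₂₄
  set x₂₅ : ℝ := min (μ 2 - x₂₃ - x₂₄) r₅ with hx₂₅
  set x₂₆ : ℝ := μ 2 - x₂₃ - x₂₄ - x₂₅ with hx₂₆
  have h15 : 0 ≤ x₁₅ := le_min (hμ0 1) hc₅0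
  have h15le : x₁₅ ≤ μ 1 := min_le_left _ _
  have h16 : 0 ≤ x₁₆ := by rw [hx₁₆]; linarith
  have hr₅0 : 0 ≤ r₅ := by rw [hr₅]; linarith [min_le_right (μ 1) c₅]
  have h23 : 0 ≤ x₂₃ := le_min (hμ0 2) hc₃0
  have h23le : x₂₃ ≤ μ 2 := min_le_left _ _
  have h24 : 0 ≤ x₂₄ := le_min (by linarith) hc₄0
  have h24le : x₂₄ ≤ μ 2 - x₂₃ := min_le_left _ _
  have h25 : 0 ≤ x₂₅ := le_min (by linarith) hr₅0
  have h25le : x₂₅ ≤ μ 2 - x₂₃ - x₂₄ := min_le_left _ _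
  have h25r : x₂₅ ≤ r₅ := min_le_right _ _
  have h26 : 0 ≤ x₂₆ := by rw [hx₂₆]; linarith
  -- overflow of the low atom 1
  have hover1 : (x₁₆ = 0 ∧ r₅ = c₅ - μ 1 ∧ μ 1 ≤ c₅) ∨ (x₁₆ = μ 1 - c₅ ∧ r₅ = 0 ∧ c₅ ≤ μ 1) := by
    rcases le_total (μ 1) c₅ with hle | hle
    · left; refine ⟨by rw [hx₁₆, hx₁₅, min_eq_left hle, sub_self], by rw [hr₅, hx₁₅, min_eq_left hle], hle⟩
    · right; refine ⟨by rw [hx₁₆, hx₁₅, min_eq_right hle], by rw [hr₅, hx₁₅, min_eq_right hle, sub_self], hle⟩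
  -- overflow of the low atom 2: either no flow into 6, or 3, 4, 5 saturated
  have hover2 : x₂₆ = 0 ∨ (x₂₆ = μ 2 - c₃ - c₄ - r₅ ∧ x₂₃ = c₃ ∧ x₂₄ = c₄ ∧ x₂₅ = r₅ ∧ c₃ + c₄ + r₅ ≤ μ 2) := by
    rcases le_total (μ 2) c₃ with hle | hle
    · left
      have e23 : x₂₃ = μ 2 := by rw [hx₂₃, min_eq_left hle]
      have e24 : x₂₄ = 0 := by rw [hx₂₄, e23, sub_self, min_eq_left hc₄0]
      have e25 : x₂₅ = 0 := by rw [hx₂₅, e23, e24, sub_self, sub_zero, min_eq_left hr₅0]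
      rw [hx₂₆, e23, e24, e25]; ring
    · have e23 : x₂₃ = c₃ := by rw [hx₂₃, min_eq_right hle]
      rcases le_total (μ 2 - c₃) c₄ with hle' | hle'
      · left
        have e24 : x₂₄ = μ 2 - c₃ := by rw [hx₂₄, e23, min_eq_left hle']
        have e25 : x₂₅ = 0 := by
          rw [hx₂₅, e23, e24]; rw [show μ 2 - c₃ - (μ 2 - c₃) = 0 by ring, min_eq_left hr₅0]
        rw [hx₂₆, e23, e24, e25]; ring
      · have e24 : x₂₄ = c₄ := by rw [hx₂₄, e23, min_eq_right hle']
        rcases le_total (μ 2 - c₃ - c₄) r₅ with hle'' | hle''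
        · left
          have e25 : x₂₅ = μ 2 - c₃ - c₄ := by rw [hx₂₅, e23, e24, min_eq_left hle'']
          rw [hx₂₆, e23, e24, e25]; ring
        · right
          have e25 : x₂₅ = r₅ := by rw [hx₂₅, e23, e24, min_eq_right hle'']
          exact ⟨by rw [hx₂₆, e23, e24, e25], e23, e24, e25, by linarith⟩
  -- x₂₃ + x₂₄ = min (μ 2) (c₃ + c₄) in the no-overflow analysis
  have h234 : x₂₃ + x₂₄ = μ 2 ∨ x₂₃ + x₂₄ = c₃ + c₄ := by
    rcases le_total (μ 2) c₃ with hle | hle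
    · left
      have e23 : x₂₃ = μ 2 := by rw [hx₂₃, min_eq_left hle]
      have e24 : x₂₄ = 0 := by rw [hx₂₄, e23, sub_self, min_eq_left hc₄0]
      rw [e23, e24, add_zero]
    · have e23 : x₂₃ = c₃ := by rw [hx₂₃, min_eq_right hle]
      rcases le_total (μ 2 - c₃) c₄ with hle' | hle'
      · left; rw [hx₂₄, e23, min_eq_left hle']; ring
      · right; rw [hx₂₄, e23, min_eq_right hle']
  -- rates are at most κ on every route used
  have hr15 : freeRate y T 1 5 ≤ κ := freeRate_le_sixth y T 1 5 hyT (by push_cast; linarith) hT6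
  have hr16 : freeRate y T 1 6 ≤ κ := freeRate_le_sixth y T 1 6 hyT (by push_cast; linarith) hT6
  have hr24 : freeRate y T 2 4 ≤ κ := freeRate_le_sixth y T 2 4 hyT (by push_cast; linarith) hT6
  have hr25 : freeRate y T 2 5 ≤ κ := freeRate_le_sixth y T 2 5 hyT (by push_cast; linarith) hT6
  have hr26 : freeRate y T 2 6 ≤ κ := freeRate_le_sixth y T 2 6 hyT (by push_cast; linarith) hT6
  refine decAt_all_of_split12b y x₁₅ x₁₆ x₂₃ x₂₄ x₂₅ x₂₆ μ T hy0 hy1 hμ0 hμM hμ1 hT hT4 hT6 (by push_cast; linarith)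
    h15 h16 h23 h24 h25 h26 (by rw [hx₁₆]; ring) (by rw [hx₂₆]; ring) ?_ ?_ ?_ ?_ ?_ ?_
  · intro hpos
    rcases hc₃ with hz | ⟨h245, _⟩
    · exfalso
      have : x₂₃ = 0 := by rw [hx₂₃, hz, min_eq_right (hμ0 2)]
      linarith
    · linarith
  · rcases hc₃ with hz | ⟨h245, hcap⟩
    · have : x₂₃ = 0 := by rw [hx₂₃, hz, min_eq_right (hμ0 2)]
      rw [this, mul_zero]; exact hμ0 3
    · have hr23 : freeRate y T 2 3 ≤ κ := freeRate_le_sixth y T 2 3 hyT (by push_cast; linarith) hT6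
      have hκc₃ : κ * c₃ ≤ μ 3 := by
        rw [hκ, div_mul_eq_mul_div, div_le_iff₀ h6T]; linarith
      calc freeRate y T 2 3 * x₂₃ ≤ κ * x₂₃ := mul_le_mul_of_nonneg_right hr23 h23
        _ ≤ κ * c₃ := mul_le_mul_of_nonneg_left (min_le_right _ _) hκ0
        _ ≤ μ 3 := hκc₃
  · calc freeRate y T 2 4 * x₂₄ ≤ κ * x₂₄ := mul_le_mul_of_nonneg_right hr24 h24
      _ ≤ κ * c₄ := mul_le_mul_of_nonneg_left (min_le_right _ _) hκ0
      _ = μ 4 := hκc₄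
  · -- the shared absorber 5: x₁₅ + x₂₅ ≤ x₁₅ + r₅ = c₅
    have hsum : x₁₅ + x₂₅ ≤ c₅ := by rw [hr₅] at h25r; linarith
    calc freeRate y T 1 5 * x₁₅ + freeRate y T 2 5 * x₂₅ ≤ κ * x₁₅ + κ * x₂₅ :=
          add_le_add (mul_le_mul_of_nonneg_right hr15 h15) (mul_le_mul_of_nonneg_right hr25 h25)
      _ = κ * (x₁₅ + x₂₅) := by ring
      _ ≤ κ * c₅ := mul_le_mul_of_nonneg_left hsum hκ0
      _ = μ 5 := hκc₅
  · -- the shared absorber 6 (Hall with N(1) ⊆ N(2))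
    have hsum : x₁₆ + x₂₆ ≤ c₆ := by
      rcases hover1 with ⟨e1, er, hle⟩ | ⟨e1, er, hle⟩ <;> rcases hover2 with e2 | ⟨e2, _, _, _, hsat⟩ <;> rw [e1, e2]
      · simpa using hc₆0
      · rw [er]; linarith
      · linarith
      · rw [er]; linarith
    calc freeRate y T 1 6 * x₁₆ + freeRate y T 2 6 * x₂₆ ≤ κ * x₁₆ + κ * x₂₆ :=
          add_le_add (mul_le_mul_of_nonneg_right hr16 h16) (mul_le_mul_of_nonneg_right hr26 h26)
      _ = κ * (x₁₆ + x₂₆) := by ring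
      _ ≤ κ * c₆ := mul_le_mul_of_nonneg_left hsum hκ0
      _ = μ 6 := hκc₆
  · -- torque cost
    have hfirst : (if T < 5 then (5 - T) * (freeRate y T 1 5 * x₁₅ + freeRate y T 2 5 * x₂₅) else 0)
        ≤ (T - 1) * x₁₅ + (T - 2) * x₂₅ := by
      split_ifs with h5
      · calc (5 - T) * (freeRate y T 1 5 * x₁₅ + freeRate y T 2 5 * x₂₅) ≤ (5 - T) * (κ * x₁₅ + κ * x₂₅) :=
              mul_le_mul_of_nonneg_left (add_le_add (mul_le_mul_of_nonneg_right hr15 h15)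
                (mul_le_mul_of_nonneg_right hr25 h25)) (sub_nonneg.2 h5.le)
          _ = ((5 - T) * κ) * x₁₅ + ((5 - T) * κ) * x₂₅ := by ring
          _ ≤ (T - 1) * x₁₅ + (T - 2) * x₂₅ := add_le_add (mul_le_mul_of_nonneg_right hci1 h15) (mul_le_mul_of_nonneg_right hci2 h25)
      · exact add_nonneg (mul_nonneg (by linarith only [hT4]) h15) (mul_nonneg (by linarith only [hT4]) h25)
    have hsecond : (6 - T) * (freeRate y T 1 6 * x₁₆ + freeRate y T 2 6 * x₂₆) ≤ T * (x₁₆ + x₂₆) := by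
      calc (6 - T) * (freeRate y T 1 6 * x₁₆ + freeRate y T 2 6 * x₂₆) ≤ (6 - T) * (κ * x₁₆ + κ * x₂₆) :=
            mul_le_mul_of_nonneg_left (add_le_add (mul_le_mul_of_nonneg_right hr16 h16)
              (mul_le_mul_of_nonneg_right hr26 h26)) h6T.le
        _ = ((6 - T) * κ) * (x₁₆ + x₂₆) := by ring
        _ = T * (x₁₆ + x₂₆) := by rw [hκT]
    have hbudget : (T - 1) * μ 1 + (T - 2) * μ 2 + M34
        ≤ ∑ l ∈ Finset.range (6 + 1), (if (1 ≤ l ∧ (l : ℝ) < T) then μ l * (T - l) else 0) := by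
      rw [hM34]; exact budget_ge_four μ T hμ0 hT4
    -- the key inequality: x₁₆ + 2·x₂₆ ≤ (T − 2)(x₂₃ + x₂₄) + M34
    have hkey : x₁₆ + 2 * x₂₆ ≤ (T - 2) * (x₂₃ + x₂₄) + M34 := by
      rcases hover2 with e2 | ⟨e2, e23, e24, e25, hsat⟩
      · rw [e2, mul_zero, add_zero]
        rcases hover1 with ⟨e1, _, _⟩ | ⟨e1, _, _⟩
        · rw [e1]; exact add_nonneg (mul_nonneg (by linarith) (by linarith)) hM0
        · rw [e1]
          rcases h234 with e | e <;> rw [e]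
          · exact hUR1
          · exact hUR2
      · rw [e23, e24]
        rcases hover1 with ⟨e1, er, _⟩ | ⟨e1, er, _⟩ <;> rw [e1, e2, er]
        · -- U < 0: 2(V + U) ≤ U + 2V ≤ R'
          have hU : μ 1 - c₅ ≤ 0 := sub_nonpos.2 (by assumption)
          linarith only [hU, hUVR]
        · simpa using hUVR
    have e15 : (T - 1) * x₁₅ + (T - 2) * x₂₅ + T * (x₁₆ + x₂₆) ≤ (T - 1) * μ 1 + (T - 2) * μ 2 + M34 := by
      have eμ1 : μ 1 = x₁₅ + x₁₆ := by rw [hx₁₆]; ring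
      have eμ2 : μ 2 = x₂₃ + x₂₄ + x₂₅ + x₂₆ := by rw [hx₂₆]; ring
      rw [eμ1, eμ2]
      linarith only [hkey]
    linarith only [hfirst, hsecond, e15, hbudget]

end LawDec
end Quant
end Summit.CriticalPhenomena.PercolationContinuityZ3.Theorems
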